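import Mathlib
import Literature.Computability.Complexity.CNF
import Summits.PneNP.PneNP.Theorems.OverlapGapAlgebraSolvableImpliesStableSectionEngine
import Summits.PneNP.PneNP.Theorems.OverlapGapAlgebraSolvableImpliesStableSectionLipschitzTransferBoost
import Summits.PneNP.PneNP.Theorems.OverlapGapAlgebraSolvableImpliesStableSectionMeanSquareTransferBoost

/-!
# PneNP / OverlapGapAlgebra — crux `SolvableImpliesStableSection` (stmt-PneNP-2463):
# the MEAN-SQUARE (ℓ²-stable) transfer (3/3) — the crux holds for every ℓ²-stable solver

Support for crux `stmt-PneNP-2463` (`Summit.PneNP.PneNP.Theses.OverlapGapAlgebra.SolvableImpliesStableSection`: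
"solvable in polynomial time with probability `≥ ε` ⇒ for all `η, ν, c > 0`, infinitely often an
`ηn`-stable, `νm`-valid section exists on `≥ e^{-cn}` of the Bresler–Huang interpolation path tuples").

* `sissMS_concl_of_meanSquareStableSolver` — for every `k ≥ 1`, `α, η, ν > 0`, every `s₂ : ℕ → ℝ` with
  `s₂(n) log³ n = o(n)` and every `ε > 0`: if, infinitely often in `n` (`m = ⌊α n⌋₊`), SOME map
  `g : instances → assignments` of MEAN-SQUARE single-literal-resample sensitivity at most `s₂(n)`,
  `∑_{(a,b)} ∑_{(Φ,ℓ)} d_H(g Φ, g Φ[(a,b) ↦ ℓ])² ≤ s₂(n) · (m k) · #Inst · 2n`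
  (average over a uniform position, instance and replacement literal), satisfies at least `ε·#Inst`
  instances of `F_k(n, m)`, then the conclusion of the crux holds for every `c > 0`, with `g` itself as
  the section.
* `sissMS_solvableImpliesStableSection_of_meanSquareStable` — the crux VERBATIM with its hypothesis
  `IsPolyTime f` REPLACED by "eventually in `n`, the decoded section `Φ ↦ (v ↦ (f ⌜Φ⌝).getD v false)`
  of `f` has mean-square single-literal-resample sensitivity at most `s₂(n)`" (no complexity hypothesis).

This is the transfer for the class of ℓ²-STABLE (low average sensitivity) solvers — the notion of
stability of the overlap-gap method itself (Gamarnik–Jagannath–Wein 2020: low-degree polynomials are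
stable in exactly this mean-square sense; Bresler–Huang 2021 Def. 2.4 / Thm 2.6). It contains the two
earlier transfer rungs as special cases — an `s`-Lipschitz section has `s₂ = s²`
(`sissLip_solvableImpliesStableSection_of_lipschitz`), a section `s`-Lipschitz at instances of maximum
clause-degree `≤ 3 log n` has `s₂ ≤ s² + n² · #{D > 3 log n}/#Inst = s² + O(e^{αke²}/n)`
(`sissT_solvableImpliesStableSection_of_typLipschitz`) — and it is strictly wider: rare recomputation
(jumps of size `n` on a `o(1/(n log³ n))`-fraction of the resamplings) is allowed. It is also the
interface through which LOCAL rules enter: a radius-`r` factor-graph rule moves only inside the two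
radius-`r` balls around the resampled literal, so its `s₂` is a neighbourhood second moment, `O(1)` at
constant `α, k, r`.

Mechanism (second moments only): literal-coordinate Efron–Stein + maximum clause-degree tail +
Chebyshev boost give `(k m)·#{V_g > ν m} ≤ (4k·k(2 + 9 s₂ log² n)/ν²)·#Inst` once `g` succeeds on
`ε·#Inst` instances (`sissMS_km_card_invalid_le`); Markov on `d_H²` gives total `ηn`-jump mass
`≤ #Inst·2n` once `s₂·(m k) ≤ (η n)²` (`sissMS_card_jump_le`); the walk engine `engine_count` of line
`Sketch` turns these into the path event on `≥ (2n)^{-4kA} - (2n)^{-k²m}` of the path tuples with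
`A = 4k·k(2 + 9 s₂ log² n)/ν² + 1`, and `4kA log(2n) = O(log n + s₂ log³ n) = o(n)` (`sissMS_numerics`,
`sissLip_asy_pointwise`) makes this `≥ e^{-cn}`.
No new definitions; axioms `propext`, `Classical.choice`, `Quot.sound`.
-/

set_option linter.dupNamespace false -- `Summit.PneNP.PneNP.…`: summit = sub-problem (D-0017)

namespace Summit.PneNP.PneNP.Theorems

open Finset Filter Asymptotics
open scoped Classical

/-- **The mean-square transfer (map form).** For every `k ≥ 1`, `α, η, ν > 0`, every `s₂ : ℕ → ℝ`
with `s₂(n) log³ n = o(n)` and every `ε > 0`: if, for infinitely many `n` (`m = ⌊α n⌋₊`), some map `g`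
with `∑_{(a,b)} ∑_{(Φ,ℓ)} d_H(g Φ, g Φ[(a,b) ↦ ℓ])² ≤ s₂(n)·(m k)·#Inst·2n` (mean-square single-literal
sensitivity at most `s₂(n)`) satisfies at least `ε·#Inst` instances of `F_k(n, m)`, then for every
`c > 0`, infinitely often, some map (such a `g` itself) realises the path event of
`SolvableImpliesStableSection` on at least `e^{-cn}·#paths` of the path tuples. -/
theorem sissMS_concl_of_meanSquareStableSolver (k : ℕ) (hk : 1 ≤ k) (α η ν : ℝ) (hα : 0 < α)
    (hη : 0 < η) (hν : 0 < ν) (s₂ : ℕ → ℝ)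
    (hs : (fun n : ℕ => s₂ n * Real.log n ^ 3) =o[atTop] (fun n : ℕ => (n : ℝ)))
    (ε : ℝ) (hε : 0 < ε)
    (hsolv : ∃ᶠ n : ℕ in atTop, ∀ m : ℕ, m = ⌊α * n⌋₊ →
      ∃ g : (Fin m → Fin k → Fin n × Bool) → (Fin n → Bool),
        (∑ a : Fin m, ∑ b : Fin k, ∑ p : (Fin m → Fin k → Fin n × Bool) × (Fin n × Bool),
          (hammingDist (g p.1) (g (Function.update p.1 a (Function.update (p.1 a) b p.2))) : ℝ) ^ 2)
          ≤ s₂ n * (((m * k : ℕ) : ℝ) * (Fintype.card (Fin m → Fin k → Fin n × Bool) * (2 * n))) ∧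
        ε * Fintype.card (Fin m → Fin k → Fin n × Bool) ≤
          ((Finset.univ.filter fun Φ : Fin m → Fin k → Fin n × Bool =>
            ∀ i, ∃ j, g Φ (Φ i j).1 = (Φ i j).2).card : ℝ))
    (c : ℝ) (hc : 0 < c) :
    ∃ᶠ n : ℕ in atTop, ∀ m : ℕ, m = ⌊α * n⌋₊ →
      ∃ g : (Fin m → Fin k → Fin n × Bool) → (Fin n → Bool),
        Real.exp (-(c * n)) * Fintype.card (Fin (k + 1) → Fin m → Fin k → Fin n × Bool) ≤
        ((Finset.univ.filter fun Ψ : Fin (k + 1) → Fin m → Fin k → Fin n × Bool =>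
          let P : Fin k → ℕ → Fin m → Fin k → Fin n × Bool :=
            fun r q a b => if (a : ℕ) * k + b < q then Ψ r.succ a b else Ψ r.castSucc a b
          (∀ r : Fin k, ∀ q ≤ m * k, ((Finset.univ.filter fun i : Fin m =>
            ∀ j, g (P r q) (P r q i j).1 ≠ (P r q i j).2).card : ℝ) ≤ ν * m) ∧
          ∀ r : Fin k, ∀ q < m * k,
            (hammingDist (g (P r q)) (g (P r (q + 1))) : ℝ) ≤ η * n).card : ℝ) := by
  have hkR : (1 : ℝ) ≤ k := by exact_mod_cast hk
  have hk0 : (0 : ℝ) < k := by linarith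
  -- the small constant `δ`
  obtain ⟨δ, hδpos, hδa, hδη, hδc, hδb⟩ : ∃ δ : ℝ, 0 < δ ∧
      δ ≤ ε * ν ^ 2 * α / (144 * k) ∧ δ ≤ η ^ 2 / (k * α) ∧ δ ≤ c * ν ^ 2 / (576 * k ^ 3) ∧
      δ ≤ α * ν ^ 2 / (288 * k) := by
    refine ⟨min (ε * ν ^ 2 * α / (144 * k))
      (min (η ^ 2 / (k * α)) (min (c * ν ^ 2 / (576 * k ^ 3)) (α * ν ^ 2 / (288 * k)))), ?_,
      min_le_left _ _, (min_le_right _ _).trans (min_le_left _ _),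
      ((min_le_right _ _).trans (min_le_right _ _)).trans (min_le_left _ _),
      ((min_le_right _ _).trans (min_le_right _ _)).trans (min_le_right _ _)⟩
    refine lt_min ?_ (lt_min ?_ (lt_min ?_ ?_)) <;> positivity
  -- eventual conditions in `n`
  have C0 : ∀ᶠ n : ℕ in atTop, 3 ≤ n := eventually_ge_atTop 3
  have C1 : ∀ᶠ n : ℕ in atTop, s₂ n * Real.log n ^ 3 ≤ δ * n := by
    filter_upwards [hs.def hδpos] with n hn
    rw [Real.norm_eq_abs, Real.norm_eq_abs, Nat.abs_cast] at hn
    exact (le_abs_self _).trans hn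
  have C3 : ∀ᶠ n : ℕ in atTop, (16 * k + ε * ν ^ 2) * 2 / (ε * ν ^ 2 * α) ≤ (n : ℝ) :=
    tendsto_natCast_atTop_atTop.eventually_ge_atTop _
  have C4 : ∀ᶠ n : ℕ in atTop, (1 + 64 * k ^ 3 / ν ^ 2 + 8 * k) * Real.log n ≤ c * n / 2 := by
    have hlo := Real.isLittleO_log_id_atTop.comp_tendsto tendsto_natCast_atTop_atTop
    have hK : (0 : ℝ) < 1 + 64 * k ^ 3 / ν ^ 2 + 8 * k := by positivity
    have hpos : 0 < c / (2 * (1 + 64 * k ^ 3 / ν ^ 2 + 8 * k)) := by positivity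
    filter_upwards [hlo.def hpos] with n hn
    simp only [Function.comp_apply, id_eq, Real.norm_eq_abs, Nat.abs_cast] at hn
    have h1 : Real.log n ≤ c / (2 * (1 + 64 * k ^ 3 / ν ^ 2 + 8 * k)) * n := (le_abs_self _).trans hn
    calc (1 + 64 * k ^ 3 / ν ^ 2 + 8 * k) * Real.log n
        ≤ (1 + 64 * k ^ 3 / ν ^ 2 + 8 * k) * (c / (2 * (1 + 64 * k ^ 3 / ν ^ 2 + 8 * k)) * n) :=
          mul_le_mul_of_nonneg_left h1 hK.le
      _ = c * n / 2 := by field_simp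
  have C5 : ∀ᶠ n : ℕ in atTop, 2 * (32 * k ^ 3 / ν ^ 2 + 4 * k + 1 + k ^ 2) / (k ^ 2 * α) ≤ (n : ℝ) :=
    tendsto_natCast_atTop_atTop.eventually_ge_atTop _
  have C7 : ∀ᶠ n : ℕ in atTop, α ^ 2 * Real.exp (α * k * Real.exp 2) ≤ (n : ℝ) :=
    tendsto_natCast_atTop_atTop.eventually_ge_atTop _
  have C8 : ∀ᶠ n : ℕ in atTop, α * ν ^ 2 * Real.exp (α * k * Real.exp 2) ≤ (n : ℝ) :=
    tendsto_natCast_atTop_atTop.eventually_ge_atTop _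
  have hev : ∀ᶠ n : ℕ in atTop, 3 ≤ n ∧ s₂ n * Real.log n ^ 3 ≤ δ * n ∧
      (16 * k + ε * ν ^ 2) * 2 / (ε * ν ^ 2 * α) ≤ (n : ℝ) ∧
      (1 + 64 * k ^ 3 / ν ^ 2 + 8 * k) * Real.log n ≤ c * n / 2 ∧
      2 * (32 * k ^ 3 / ν ^ 2 + 4 * k + 1 + k ^ 2) / (k ^ 2 * α) ≤ (n : ℝ) ∧
      α ^ 2 * Real.exp (α * k * Real.exp 2) ≤ (n : ℝ) ∧
      α * ν ^ 2 * Real.exp (α * k * Real.exp 2) ≤ (n : ℝ) := by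
    filter_upwards [C0, C1, C3, C4, C5, C7, C8] with n h0 h1 h3 h4 h5 h7 h8
    exact ⟨h0, h1, h3, h4, h5, h7, h8⟩
  refine (hsolv.and_eventually hev).mono ?_
  rintro n ⟨hn, hn3, hC1, hC3, hC4, hC5, hC7, hC8⟩ m hm
  obtain ⟨g, hg, hsucc⟩ := hn m hm
  refine ⟨g, ?_⟩
  -- numerics of `n` and `m`
  have hn1 : 1 ≤ n := le_trans (by norm_num) hn3
  have hnR : (1 : ℝ) ≤ n := by exact_mod_cast hn1
  have hn3R : (3 : ℝ) ≤ n := by exact_mod_cast hn3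
  have hnpos : (0 : ℝ) < n := by linarith only [hnR]
  have hxpos : (0 : ℝ) < 2 * n := by linarith only [hnR]
  have hlog2le : Real.log 2 ≤ Real.log (2 * n) := Real.log_le_log two_pos (by linarith only [hnR])
  have hlog1 : 1 ≤ Real.log n := by
    rw [← Real.log_exp 1]
    apply Real.log_le_log (Real.exp_pos 1)
    have : Real.exp 1 ≤ 3 := le_of_lt (lt_trans Real.exp_one_lt_d9 (by norm_num))
    exact this.trans hn3R
  have hm_le : (m : ℝ) ≤ α * n := by rw [hm]; exact Nat.floor_le (by positivity)
  have hm_ge : α * n - 1 ≤ m := by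
    rw [hm]; have := Nat.lt_floor_add_one (α * n); linarith only [this]
  -- a nonnegative sensitivity level `s' ≥ s₂ n`
  obtain ⟨s', hs'0, hs'ge, hC1'⟩ : ∃ s' : ℝ, 0 ≤ s' ∧ s₂ n ≤ s' ∧ s' * Real.log n ^ 3 ≤ δ * n := by
    refine ⟨max (s₂ n) 0, le_max_right _ _, le_max_left _ _, ?_⟩
    rcases le_or_gt 0 (s₂ n) with h | h
    · rw [max_eq_left h]; exact hC1
    · rw [max_eq_right h.le, zero_mul]; positivity
  set N : ℝ := (Fintype.card (Fin m → Fin k → Fin n × Bool) : ℝ) with hN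
  have hX0 : 0 ≤ ((m * k : ℕ) : ℝ) * (N * (2 * n)) := by positivity
  have hg' : (∑ a : Fin m, ∑ b : Fin k, ∑ p : (Fin m → Fin k → Fin n × Bool) × (Fin n × Bool),
      (hammingDist (g p.1) (g (Function.update p.1 a (Function.update (p.1 a) b p.2))) : ℝ) ^ 2)
      ≤ s' * (((m * k : ℕ) : ℝ) * (N * (2 * n))) :=
    hg.trans (mul_le_mul_of_nonneg_right hs'ge hX0)
  obtain ⟨hm1, hjumpB, h8B, ht, hMB⟩ := sissMS_numerics k hk α η ν ε c δ s' hα hν hε hc hs'0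
    hδa hδη hδc hδb n m hn3 hC1' hC3 hC4 hC5 hm_ge hm_le
  -- the degree level `L = ⌈2 log n⌉₊ ≤ 3 log n`
  set L : ℕ := ⌈2 * Real.log n⌉₊ with hL
  have hLge : 2 * Real.log n ≤ L := Nat.le_ceil _
  have hLle : (L : ℝ) ≤ 3 * Real.log n := by
    have := Nat.ceil_lt_add_one (show 0 ≤ 2 * Real.log n by positivity)
    rw [← hL] at this
    linarith only [this, hlog1]
  have hL9 : (L : ℝ) ^ 2 * s' ≤ 9 * Real.log n ^ 2 * s' := by
    have h1 : (L : ℝ) ^ 2 ≤ (3 * Real.log n) ^ 2 := pow_le_pow_left₀ (Nat.cast_nonneg _) hLle 2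
    have h2 : (3 * Real.log n) ^ 2 = 9 * Real.log n ^ 2 := by ring
    rw [← h2]
    exact mul_le_mul_of_nonneg_right h1 hs'0
  -- the exceptional set (maximum clause-degree `> L`) is negligible
  haveI : Nonempty (Fin n × Bool) := ⟨(⟨0, hn1⟩, true)⟩
  have hNpos : 0 < N := by rw [hN]; exact_mod_cast Fintype.card_pos
  have hBad := (sissT_bad_bounds (m := m) (k := k) (n := n) hn1 α ν hα.le hν L hm_le hLge hC7 hC8).1
  -- the loss rate `A` and the good set `G`
  obtain ⟨A, hA⟩ : ∃ A : ℝ, A = 4 * k * (k * (2 + 9 * Real.log n ^ 2 * s')) / ν ^ 2 + 1 := ⟨_, rfl⟩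
  have hA0 : 0 ≤ A := by rw [hA]; positivity
  have hA1 : 1 ≤ A := by
    rw [hA]
    have : 0 ≤ 4 * k * (k * (2 + 9 * Real.log n ^ 2 * s')) / ν ^ 2 := by positivity
    linarith only [this]
  have hν2 : 0 < ν ^ 2 := by positivity
  have hAL : 4 * k * (k * (2 + (L : ℝ) ^ 2 * s')) / ν ^ 2 ≤ A := by
    rw [hA]
    have h1 : 4 * (k : ℝ) * (k * (2 + (L : ℝ) ^ 2 * s')) ≤ 4 * k * (k * (2 + 9 * Real.log n ^ 2 * s')) := by
      apply mul_le_mul_of_nonneg_left _ (by positivity)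
      apply mul_le_mul_of_nonneg_left _ hk0.le
      linarith only [hL9]
    have h2 := div_le_div_of_nonneg_right h1 hν2.le
    linarith only [h2]
  rw [← hA] at ht hMB
  have h8BL : 8 * (k * (2 + (L : ℝ) ^ 2 * s')) ≤ ε * ν ^ 2 * m := by
    have : 8 * ((k : ℝ) * (2 + (L : ℝ) ^ 2 * s')) ≤ 8 * (k * (2 + 9 * Real.log n ^ 2 * s')) := by
      apply mul_le_mul_of_nonneg_left _ (by norm_num)
      apply mul_le_mul_of_nonneg_left _ hk0.le
      linarith only [hL9]
    exact this.trans h8B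
  obtain ⟨G, hGdef⟩ : ∃ G : Finset (Fin m → Fin k → Fin n × Bool),
      G = (univ : Finset (Fin m → Fin k → Fin n × Bool)).filter fun Φ =>
        ((((univ : Finset (Fin m)).filter fun i => ∀ j, g Φ (Φ i j).1 ≠ (Φ i j).2).card : ℕ) : ℝ)
          ≤ ν * m := ⟨_, rfl⟩
  have hval : ∀ Φ ∈ G, ((((univ : Finset (Fin m)).filter fun i =>
      ∀ j, g Φ (Φ i j).1 ≠ (Φ i j).2).card : ℕ) : ℝ) ≤ ν * m := fun Φ hΦ => by
    rw [hGdef] at hΦ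
    exact (Finset.mem_filter.1 hΦ).2
  have hG : ((k * m : ℕ) : ℝ) * (Gᶜ.card : ℝ) ≤ A * Fintype.card (Fin m → Fin k → Fin n × Bool) := by
    have h := sissMS_km_card_invalid_le hn1 hm1 g s' ν ε hs'0 hν hε L hg' hBad hsucc h8BL G hGdef
    exact h.trans (mul_le_mul_of_nonneg_right hAL (Nat.cast_nonneg _))
  -- jump mass by Markov on the squared sensitivity: total `≤ #Inst · 2n ≤ A · #Inst · 2n`
  have hjump : (∑ a : Fin m, ∑ b : Fin k,
      (((Finset.univ : Finset ((Fin m → Fin k → Fin n × Bool) × (Fin n × Bool))).filter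
        fun p => η * n < hammingDist (g p.1)
          (g (Function.update p.1 a (Function.update (p.1 a) b p.2)))).card : ℝ))
      ≤ A * (Fintype.card (Fin m → Fin k → Fin n × Bool) * (2 * n)) := by
    have hηn : 0 < (η * n) ^ 2 := by positivity
    have hsum : (η * n) ^ 2 * (∑ a : Fin m, ∑ b : Fin k,
        (((Finset.univ : Finset ((Fin m → Fin k → Fin n × Bool) × (Fin n × Bool))).filter
          fun p => η * n < hammingDist (g p.1)
            (g (Function.update p.1 a (Function.update (p.1 a) b p.2)))).card : ℝ))
        ≤ ∑ a : Fin m, ∑ b : Fin k, ∑ p : (Fin m → Fin k → Fin n × Bool) × (Fin n × Bool),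
          (hammingDist (g p.1) (g (Function.update p.1 a (Function.update (p.1 a) b p.2))) : ℝ) ^ 2 := by
      rw [Finset.mul_sum]
      refine Finset.sum_le_sum fun a _ => ?_
      rw [Finset.mul_sum]
      exact Finset.sum_le_sum fun b _ => sissMS_card_jump_le g (η * n) (by positivity) a b
    have hchain : (η * n) ^ 2 * (∑ a : Fin m, ∑ b : Fin k,
        (((Finset.univ : Finset ((Fin m → Fin k → Fin n × Bool) × (Fin n × Bool))).filter
          fun p => η * n < hammingDist (g p.1)
            (g (Function.update p.1 a (Function.update (p.1 a) b p.2)))).card : ℝ))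
        ≤ (η * n) ^ 2 * (A * (N * (2 * n))) := by
      calc _ ≤ s' * (((m * k : ℕ) : ℝ) * (N * (2 * n))) := hsum.trans hg'
        _ = (s' * ((m * k : ℕ) : ℝ)) * (N * (2 * n)) := by ring
        _ ≤ (η * n) ^ 2 * (N * (2 * n)) := mul_le_mul_of_nonneg_right hjumpB (by positivity)
        _ = (η * n) ^ 2 * (1 * (N * (2 * n))) := by ring
        _ ≤ (η * n) ^ 2 * (A * (N * (2 * n))) := by
            apply mul_le_mul_of_nonneg_left _ hηn.le
            exact mul_le_mul_of_nonneg_right hA1 (by positivity)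
    have := le_of_mul_le_mul_left hchain hηn
    simpa only [hN, mul_assoc] using this
  -- the engine and the growing-loss asymptotics
  have hE := Summit.PneNP.PneNP.Cruxes.SolvableImpliesStableSection.Sketch.engine_count k m n hn1 η A
    hη.le hA0 g G hG hjump
  have hasym := sissLip_asy_pointwise (M := m * k) (k := k) (Real.exp_log hxpos) hlog2le ht hMB
  -- assembly (as in `concl_of_smoothSection`)
  have hpaths : (Fintype.card (Fin (k + 1) → Fin m → Fin k → Fin n × Bool) : ℝ) =
      (2 * n) ^ (m * k * (k + 1)) := by
    rw [Summit.PneNP.PneNP.Cruxes.SolvableImpliesStableSection.Sketch.eng_card_paths]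
    push_cast
    ring
  have hmono : ((univ : Finset (Fin (k + 1) → Fin m → Fin k → Fin n × Bool)).filter fun Ψ =>
          (∀ r : Fin k, ∀ q ≤ m * k,
            (fun (a : Fin m) (b : Fin k) =>
              if (a : ℕ) * k + b < q then Ψ r.succ a b else Ψ r.castSucc a b) ∈ G) ∧
          ∀ r : Fin k, ∀ q < m * k,
            (hammingDist
              (g fun (a : Fin m) (b : Fin k) =>
                if (a : ℕ) * k + b < q then Ψ r.succ a b else Ψ r.castSucc a b)
              (g fun (a : Fin m) (b : Fin k) =>
                if (a : ℕ) * k + b < q + 1 then Ψ r.succ a b else Ψ r.castSucc a b) : ℝ)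
              ≤ η * n).card ≤
      ((univ : Finset (Fin (k + 1) → Fin m → Fin k → Fin n × Bool)).filter fun Ψ =>
        let P : Fin k → ℕ → Fin m → Fin k → Fin n × Bool :=
          fun r q a b => if (a : ℕ) * k + b < q then Ψ r.succ a b else Ψ r.castSucc a b
        (∀ r : Fin k, ∀ q ≤ m * k, (((Finset.univ : Finset (Fin m)).filter fun i =>
          ∀ j, g (P r q) (P r q i j).1 ≠ (P r q i j).2).card : ℝ) ≤ ν * m) ∧
        ∀ r : Fin k, ∀ q < m * k,
          (hammingDist (g (P r q)) (g (P r (q + 1))) : ℝ) ≤ η * n).card := by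
    refine Finset.card_le_card fun Ψ hΨ => ?_
    simp only [Finset.mem_filter, Finset.mem_univ, true_and] at hΨ ⊢
    obtain ⟨hin, hjmp⟩ := hΨ
    exact ⟨fun r q hq => hval _ (hin r q hq), fun r q hq => hjmp r q hq⟩
  have hmono' := (Nat.cast_le (α := ℝ)).2 hmono
  rw [hpaths]
  linarith only [hasym, hE, hmono']

/-- **The mean-square transfer: `SolvableImpliesStableSection` HOLDS on the class of ℓ²-stable
solvers.** For every `k ≥ 1`, `α, η, ν > 0` and `s₂` with `s₂(n) log³ n = o(n)`: the crux
`SolvableImpliesStableSection` verbatim, with its hypothesis `IsPolyTime f` REPLACED by "eventually in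
`n`, the decoded section `Φ ↦ (v ↦ (f ⌜Φ⌝).getD v false)` of `f` on `F_k(n, ⌊α n⌋₊)` has mean-square
single-literal-resample sensitivity at most `s₂(n)`": `∑_{(a,b)} ∑_{(Φ,ℓ)} d_H(g Φ, g Φ[(a,b) ↦ ℓ])²
≤ s₂(n)·(m k)·#Inst·2n` (no complexity hypothesis). The Lipschitz and typically-Lipschitz transfers are
the special cases `s₂ = s²` and `s₂ = s² + O(1/n)`; the open content of the crux is the transfer for
polynomial-time solvers whose sections are not ℓ²-stable at scale `o(n / log³ n)`. -/
theorem sissMS_solvableImpliesStableSection_of_meanSquareStable (k : ℕ) (hk : 1 ≤ k) (α η ν : ℝ)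
    (hα : 0 < α) (hη : 0 < η) (hν : 0 < ν) (s₂ : ℕ → ℝ)
    (hs : (fun n : ℕ => s₂ n * Real.log n ^ 3) =o[atTop] (fun n : ℕ => (n : ℝ)))
    (hsolv : ∃ f : List Bool → List Bool,
      (∀ᶠ n : ℕ in atTop, ∀ m : ℕ, m = ⌊α * n⌋₊ →
        ∃ g : (Fin m → Fin k → Fin n × Bool) → (Fin n → Bool),
          (∀ (Φ : Fin m → Fin k → Fin n × Bool) (v : Fin n), g Φ v =
            (f (Literature.Computability.Complexity.encodingCNF.encode (List.ofFn fun a =>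
              List.ofFn fun b => (((Φ a b).1 : ℕ), (Φ a b).2)))).getD v false) ∧
          (∑ a : Fin m, ∑ b : Fin k, ∑ p : (Fin m → Fin k → Fin n × Bool) × (Fin n × Bool),
            (hammingDist (g p.1) (g (Function.update p.1 a (Function.update (p.1 a) b p.2))) : ℝ) ^ 2)
            ≤ s₂ n * (((m * k : ℕ) : ℝ) * (Fintype.card (Fin m → Fin k → Fin n × Bool) * (2 * n)))) ∧
      ∃ ε : ℝ, 0 < ε ∧ ∃ᶠ n : ℕ in Filter.atTop, ∀ m : ℕ, m = ⌊α * n⌋₊ → ε ≤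
        ((Finset.univ.filter fun Φ : Fin m → Fin k → Fin n × Bool => ∀ i, ∃ j,
          (f (Literature.Computability.Complexity.encodingCNF.encode (List.ofFn fun a =>
            List.ofFn fun b => (((Φ a b).1 : ℕ), (Φ a b).2)))).getD (Φ i j).1 false =
              (Φ i j).2).card : ℝ) / Fintype.card (Fin m → Fin k → Fin n × Bool))
    (c : ℝ) (hc : 0 < c) :
    ∃ᶠ n : ℕ in Filter.atTop, ∀ m : ℕ, m = ⌊α * n⌋₊ →
      ∃ g : (Fin m → Fin k → Fin n × Bool) → (Fin n → Bool),
        Real.exp (-(c * n)) * Fintype.card (Fin (k + 1) → Fin m → Fin k → Fin n × Bool) ≤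
        ((Finset.univ.filter fun Ψ : Fin (k + 1) → Fin m → Fin k → Fin n × Bool =>
          let P : Fin k → ℕ → Fin m → Fin k → Fin n × Bool :=
            fun r q a b => if (a : ℕ) * k + b < q then Ψ r.succ a b else Ψ r.castSucc a b
          (∀ r : Fin k, ∀ q ≤ m * k, ((Finset.univ.filter fun i : Fin m =>
            ∀ j, g (P r q) (P r q i j).1 ≠ (P r q i j).2).card : ℝ) ≤ ν * m) ∧
          ∀ r : Fin k, ∀ q < m * k,
            (hammingDist (g (P r q)) (g (P r (q + 1))) : ℝ) ≤ η * n).card : ℝ) := by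
  obtain ⟨f, hMS, ε, hε, hfreq⟩ := hsolv
  refine sissMS_concl_of_meanSquareStableSolver k hk α η ν hα hη hν s₂ hs ε hε ?_ c hc
  refine (hfreq.and_eventually (hMS.and (eventually_ge_atTop 1))).mono ?_
  rintro n ⟨hn, hMSn, hn1⟩ m hm
  obtain ⟨g, hgf, hg⟩ := hMSn m hm
  refine ⟨g, hg, ?_⟩
  have h := hn m hm
  haveI : Nonempty (Fin n × Bool) := ⟨(⟨0, hn1⟩, false)⟩
  have hN : (0 : ℝ) < Fintype.card (Fin m → Fin k → Fin n × Bool) := by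
    exact_mod_cast Fintype.card_pos
  rw [le_div_iff₀ hN] at h
  have hset : ((Finset.univ.filter fun Φ : Fin m → Fin k → Fin n × Bool => ∀ i, ∃ j,
      (f (Literature.Computability.Complexity.encodingCNF.encode (List.ofFn fun a =>
        List.ofFn fun b => (((Φ a b).1 : ℕ), (Φ a b).2)))).getD (Φ i j).1 false = (Φ i j).2))
      = (Finset.univ.filter fun Φ : Fin m → Fin k → Fin n × Bool =>
          ∀ i, ∃ j, g Φ (Φ i j).1 = (Φ i j).2) := by
    refine Finset.filter_congr fun Φ _ => ?_
    simp only [hgf]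
  rw [hset] at h
  exact h

end Summit.PneNP.PneNP.Theorems
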